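import Literature.AnabelianGeometry.SemiGraphs.TemperedResiduallyFiniteTransport
import Literature.AnabelianGeometry.SemiGraphs.TemperedCoveringsComponents
import HarnessLib

/-!
# [SemiAnbd] Prop. 3.6 (iii): the pointed form of the Galois-domination reduction

`TemperedResiduallyFiniteTransport` reduces `TemperedPiResiduallyFinite` (residual finiteness of
`π₁^temp(𝒢)`, [SemiAnbd] Prop. 3.6 (iii) p. 38) to *Galois domination inside `B^temp(𝒢)`*:
every categorically connected object `S` of `B^temp(𝒢)` receives an arrow from a Galois object
with residually finite automorphism group.  The natural output of the covering-theoretic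
construction of p. 38 (the coverings `𝒢_{∞,F} → 𝒢` attached to finite étale coverings `F`,
`UniversalCoveringOverDevelopProofs.lean`) is an arrow `H ⟶ S` through a *given point* of `S`;
since a categorically connected object of `B^temp(𝒢)` has a point
(`TemperedCoveringsComponents.lean`), the reduction holds with the hypothesis in pointed form.
-/

namespace Literature.AnabelianGeometry.SemiGraphs

open CategoryTheory CategoryTheory.Limits
open Literature.AlgebraicGeometry.Frobenioids (IsConnectedObj IsNonemptyObj)
open GaloisObjects

universe u

namespace ProfiniteSemiGraph

/-- **Pointed Galois domination ⇒ Prop. 3.6 (iii).**  If, for every `𝒢` satisfying the hypotheses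
of Prop. 3.6 and every point `p` of every object `S` of `B^temp(𝒢)`, some Galois object `H` of
`B^temp(𝒢)` with residually finite `Aut H` maps to `S` (p. 38: the coverings `𝒢'_∞ → 𝒢`, whose
Galois groups are extensions of the finite `Gal(𝒢'/𝒢)` by the free group `π₁(𝔾')`), then
`π₁^temp(𝒢)` is residually finite for every tempered fundamental group chart.  This is
`temperedPiResiduallyFinite_of_galoisDomination` with its connectedness hypothesis traded for a
point via `nonempty_point_of_isConnectedObj`. [cite: MochizukiSemiAnbd2006, Prop 3.6(iii) p.38] -/
theorem temperedPiResiduallyFinite_of_pointedGaloisDomination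
    (hGal : ∀ (𝒢 : ProfiniteSemiGraph.{u}), 𝒢.Prop36Hypotheses →
      ∀ (S : BTempCat 𝒢) (_ : S.obj.Point),
        ∃ (H : BTempCat 𝒢) (_ : H ⟶ S), IsGaloisObj H ∧ Group.ResiduallyFinite (Aut H)) :
    TemperedPiResiduallyFinite.{u} :=
  temperedPiResiduallyFinite_of_galoisDomination fun 𝒢 h𝒢 S hS =>
    (nonempty_point_of_isConnectedObj S hS).elim fun p => hGal 𝒢 h𝒢 S p

end ProfiniteSemiGraph

end Literature.AnabelianGeometry.SemiGraphs
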